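import Mathlib
import Summits.Ventures.HodgeRepro.Tier4.Line4.ArchBallMixed
import Summits.Ventures.HodgeRepro.Tier4.Line4.SeesawSigns
import Summits.Ventures.HodgeRepro.Tier4.Line4.ArchMatchingCutoff
import Summits.Ventures.HodgeRepro.Tier4.Line4.ArchCutoffLarge

/-!
# Tier4/Line4/ArchMatchingSigns — display (7a)'s `integrable` print DISCHARGED from the (8)-side sign clause: the support
lemmas of C-L4-7A-NODEF with `hgrowth : ArchBallGrowth` REPLACED by `hSD : SeesawDefinite q a (mk φ)` (and no `μ∞` binder)

Blind re-derivation cell `pub-hodge-repro`, Tier 4 (README §9–§10), seat t4-L1-p5 (prover, gen 5; L4-p2 g5's S15933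
«`ArchBallGrowth … μ∞` for (7a)'s `hgrowth` is M4's statement — bind it on ACCEPT»).  Target tree path
`lean/Summits/Ventures/HodgeRepro/Tier4/Line4/ArchMatchingSigns.lean`.  On L4-p2's `ArchBallMixed`
(`archBallGrowth_mixedRow_withTransportedTorus`: display (8)'s print for EVERY Haar `μ∞` from the sign data), this seat's
`SeesawSigns` (`alphaLoc_pos_of_hpos`, `betaLoc_neg_of_hpos`, `SeesawDefinite`, `hdef_of_seesawDefinite`),
`ArchMatchingCutoff` (`d3CoeffData'_seesawR`, `_exists`), `ArchCutoffLarge` (`d3CoeffData'_seesawR_of_uncut`); typer-2's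
`disc_ne_zero_of_isCMAt` (LocalUnitary), L4-p1's `locallyCompact_infinitePart`; Mathlib's `Measure.haar`.  No printed input.

WHAT IS PROVED (kernel, no print): **`archBallGrowth_seesaw_of_seesawDefinite`** — on the line's plane
`(mixedRow q (a 0) (a 2)).withTransportedTorus …`, from the wall's `_hpos` (the `U(1,1)` signs at `w₀ = mk φ`), `hcm`,
total reality and the ONE clause `SeesawDefinite q a (mk φ)`: `ArchBallGrowth W μ∞` for every Haar `μ∞` (M4 with
`hw := hreal _`, `hq := disc_ne_zero_of_isCMAt`, `hα hβ` from `_hpos`, `hdef := hdef_of_seesawDefinite hSD`); and the three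
(7a) support lemmas with `(μinf) [μinf.IsHaarMeasure] (hgrowth)` REPLACED by `(hSD : SeesawDefinite q a (mk φ))` — the Haar
measure is CHOSEN inside (`Measure.haar` on the locally compact `G_∞`), no measure binder remains:
**`d3CoeffData'_seesawR_of_seesawDefinite`** (prints at one radius `Rc ≥ 0`), **`d3CoeffData'_seesawR_exists_of_seesawDefinite`**
(`∃ Rc ≥ 0, hF Rc ∧ hpseudo Rc ∧ hpseudo' Rc`), **`d3CoeffData'_seesawR_of_uncut_of_seesawDefinite`** (`hF` radius-free +
`hpseudo_cof`).  (7a) PRINT CENSUS in this packaging: `SeesawDefinite q a (w₀ d)` (the (8) display, SHARED) + `hF` +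
`hpseudo`/`hpseudo'`; neither `hdef` on the second row nor `ArchBallGrowth` nor `μ∞` appears.  Nothing here says anything
about the status of the Hodge conjecture for CM abelian varieties, which is NOT proved (HC_CM is NOT proved by anyone in
this repository).
-/

set_option autoImplicit false

noncomputable section

namespace Summit.Ventures.HodgeRepro.Tier4.Line4

open Summit.Ventures.HodgeRepro.Tier4.Common Summit.Ventures.HodgeRepro.Tier4.Common.SL2Ball
  Summit.Ventures.HodgeRepro.Tier4.Line1 Summit.Ventures.HodgeRepro.Tier4.Line4.L1Class NumberField Matrix MeasureTheory
  Topology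

open scoped ComplexConjugate

open scoped Classical

section Growth

variable {k : Type} [Field k] [NumberField k]

/-- **display (8)'s print from the sign data, on the line's plane, at the wall's binders**: `ArchBallGrowth W μ∞` for every
Haar `μ∞` from `_hpos` (signs at `w₀ = mk φ`), `hcm`, total reality and `SeesawDefinite q a (mk φ)`. -/
theorem archBallGrowth_seesaw_of_seesawDefinite (q : QuadData k) (a : Fin 4 → k) (φ : k →+* ℂ)
    (hpos : ∀ i, 0 < (φ (a i)).re)
    (g g' : Matrix (Fin 4) (Fin 4) k) (hgg' : g * g' = 1) (hg'g : g' * g = 1)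
    (hgΩ : g * (PlaneData.mixedRow q (a 0) (a 2)).Ω = (PlaneData.mixedRow q (a 0) (a 2)).Ω * g)
    (hreal : ∀ w : InfinitePlace k, w.IsReal) (hcm : ∀ w, IsCMAt q w)
    (hSD : SeesawDefinite q a (InfinitePlace.mk φ))
    [MeasurableSpace (GA ((PlaneData.mixedRow q (a 0) (a 2)).withTransportedTorus g g' hgg' hg'g hgΩ))] [BorelSpace (GA ((PlaneData.mixedRow q (a 0) (a 2)).withTransportedTorus g g' hgg' hg'g hgΩ))]
    (μinf : Measure (infinitePart ((PlaneData.mixedRow q (a 0) (a 2)).withTransportedTorus g g' hgg' hg'g hgΩ))) [μinf.IsHaarMeasure] :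
    ArchBallGrowth ((PlaneData.mixedRow q (a 0) (a 2)).withTransportedTorus g g' hgg' hg'g hgΩ) μinf := by
  have hw : (InfinitePlace.mk φ).IsReal := hreal _
  exact archBallGrowth_mixedRow_withTransportedTorus q (a 0) (a 2) g g' hgg' hg'g hgΩ hw (hcm _)
    (disc_ne_zero_of_isCMAt q _ hw (hcm _)) (alphaLoc_pos_of_hpos φ hw a hpos) (betaLoc_neg_of_hpos φ hw a hpos)
    (hdef_of_seesawDefinite hSD) μinf

end Growth

section Seesaw

variable {E : Type} [Field E] [NumberField E]

/-- **THE (7a) SUPPORT LEMMA WITH `integrable` DISCHARGED FROM THE (8) SIGN CLAUSE**: `d3CoeffData'_seesawR` with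
`(μinf) [μinf.IsHaarMeasure] (hgrowth : ArchBallGrowth …)` replaced by `(hSD : SeesawDefinite q a (mk φ))`; the Haar measure
on `G_∞` is chosen inside (`Measure.haar`). -/
theorem d3CoeffData'_seesawR_of_seesawDefinite (q : QuadData ↥(maximalRealSubfield E)) (a : Fin 4 → ↥(maximalRealSubfield E))
    (_ha : ∀ i, a i ≠ 0) (φ : ↥(maximalRealSubfield E) →+* ℂ) (_hpos : ∀ i, 0 < (φ (a i)).re)
    (g g' : Matrix (Fin 4) (Fin 4) ↥(maximalRealSubfield E)) (hgg' : g * g' = 1) (hg'g : g' * g = 1)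
    (hgΩ : g * (PlaneData.mixedRow q (a 0) (a 2)).Ω = (PlaneData.mixedRow q (a 0) (a 2)).Ω * g)
    (lam : ↥(maximalRealSubfield E)) (_hlam : lam ≠ 0)
    (_hiso : g * (PlaneData.mixedRow q (a 1) (a 3)).B * gᵀ = lam • (PlaneData.mixedRow q (a 0) (a 2)).B)
    [MeasurableSpace (GA ((PlaneData.mixedRow q (a 0) (a 2)).withTransportedTorus g g' hgg' hg'g hgΩ))]
    [BorelSpace (GA ((PlaneData.mixedRow q (a 0) (a 2)).withTransportedTorus g g' hgg' hg'g hgΩ))]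
    (R : RTFData ((PlaneData.mixedRow q (a 0) (a 2)).withTransportedTorus g g' hgg' hg'g hgΩ))
    [R.μT.IsHaarMeasure] [R.μT'.IsHaarMeasure]
    (eP eM eP' eM' : InfinitePlace ↥(maximalRealSubfield E) → ℤ)
    (_he : eP (InfinitePlace.mk φ) - eM (InfinitePlace.mk φ) = 3 ∨ eP (InfinitePlace.mk φ) - eM (InfinitePlace.mk φ) = -3)
    (_he' : (0 < (φ lam).re → eP' (InfinitePlace.mk φ) - eM' (InfinitePlace.mk φ) =
        eP (InfinitePlace.mk φ) - eM (InfinitePlace.mk φ)) ∧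
      ((φ lam).re < 0 → eP' (InfinitePlace.mk φ) - eM' (InfinitePlace.mk φ) =
        -(eP (InfinitePlace.mk φ) - eM (InfinitePlace.mk φ))))
    (_hchi' : ∀ w : InfinitePlace ↥(maximalRealSubfield E),
      ChiMatchesAt' ((PlaneData.mixedRow q (a 0) (a 2)).withTransportedTorus g g' hgg' hg'g hgΩ) q w g g' (eP' w) (eM' w)
        R.chi')
    (μ : Measure (GA ((PlaneData.mixedRow q (a 0) (a 2)).withTransportedTorus g g' hgg' hg'g hgΩ))) [μ.IsHaarMeasure]
    (DG : Set (GA ((PlaneData.mixedRow q (a 0) (a 2)).withTransportedTorus g g' hgg' hg'g hgΩ)))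
    (fdG : IsFundamentalDomain (rationalPoints ((PlaneData.mixedRow q (a 0) (a 2)).withTransportedTorus g g' hgg' hg'g hgΩ))
      DG μ)
    (compG : IsCompact (closure DG)) (compT : IsCompact (closure R.DT)) (compT' : IsCompact (closure R.DT'))
    (hcm : ∀ w : InfinitePlace ↥(maximalRealSubfield E), IsCMAt q w)
    (γ₀ : GA ((PlaneData.mixedRow q (a 0) (a 2)).withTransportedTorus g g' hgg' hg'g hgΩ))
    (νinf : Measure (torusInf ((PlaneData.mixedRow q (a 0) (a 2)).withTransportedTorus g g' hgg' hg'g hgΩ)))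
    (νinf' : Measure (torusInf' ((PlaneData.mixedRow q (a 0) (a 2)).withTransportedTorus g g' hgg' hg'g hgΩ)))
    [νinf'.IsHaarMeasure]
    (hSD : SeesawDefinite q a (InfinitePlace.mk φ))
    (Rc : ℝ) (hRc : 0 ≤ Rc)
    (hF : (∫ t : torusInf ((PlaneData.mixedRow q (a 0) (a 2)).withTransportedTorus g g' hgg' hg'g hgΩ),
        R.chi t * archWitnessROf q a g g' hgg' hg'g hgΩ lam _hiso (InfinitePlace.mk φ) eP' eM' Rc
          (((t : torusT ((PlaneData.mixedRow q (a 0) (a 2)).withTransportedTorus g g' hgg' hg'g hgΩ)) :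
            GA ((PlaneData.mixedRow q (a 0) (a 2)).withTransportedTorus g g' hgg' hg'g hgΩ))⁻¹ * γ₀) ∂νinf) ≠ 0)
    (hpseudo : ∀ ffin : GA ((PlaneData.mixedRow q (a 0) (a 2)).withTransportedTorus g g' hgg' hg'g hgΩ) → ℂ,
      L1Class.IsFinFactor ((PlaneData.mixedRow q (a 0) (a 2)).withTransportedTorus g g' hgg' hg'g hgΩ) ffin →
      IsPseudoCoeffAt ((PlaneData.mixedRow q (a 0) (a 2)).withTransportedTorus g g' hgg' hg'g hgΩ)
        (Setting.ofAdelicData ((PlaneData.mixedRow q (a 0) (a 2)).withTransportedTorus g g' hgg' hg'g hgΩ) R μ DG fdG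
          compG compT compT') q (InfinitePlace.mk φ) eP eM
        (RTF.cj (L1Class.prodFn ((PlaneData.mixedRow q (a 0) (a 2)).withTransportedTorus g g' hgg' hg'g hgΩ)
          (archWitnessROf q a g g' hgg' hg'g hgΩ lam _hiso (InfinitePlace.mk φ) eP' eM' Rc) ffin)))
    (hpseudo' : ∀ ffin : GA ((PlaneData.mixedRow q (a 0) (a 2)).withTransportedTorus g g' hgg' hg'g hgΩ) → ℂ,
      L1Class.IsFinFactor ((PlaneData.mixedRow q (a 0) (a 2)).withTransportedTorus g g' hgg' hg'g hgΩ) ffin →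
      IsPseudoCoeffAt' ((PlaneData.mixedRow q (a 0) (a 2)).withTransportedTorus g g' hgg' hg'g hgΩ)
        (Setting.ofAdelicData ((PlaneData.mixedRow q (a 0) (a 2)).withTransportedTorus g g' hgg' hg'g hgΩ) R μ DG fdG
          compG compT compT') q g g' (InfinitePlace.mk φ) eP' eM'
        (RTF.cj (L1Class.prodFn ((PlaneData.mixedRow q (a 0) (a 2)).withTransportedTorus g g' hgg' hg'g hgΩ)
          (archWitnessROf q a g g' hgg' hg'g hgΩ lam _hiso (InfinitePlace.mk φ) eP' eM' Rc) ffin))) :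
    L1Class.D3CoeffData' ((PlaneData.mixedRow q (a 0) (a 2)).withTransportedTorus g g' hgg' hg'g hgΩ)
      (Setting.ofAdelicData ((PlaneData.mixedRow q (a 0) (a 2)).withTransportedTorus g g' hgg' hg'g hgΩ) R μ DG fdG
        compG compT compT') R q g g' (InfinitePlace.mk φ) eP eM eP' eM' γ₀ νinf νinf' := by
  have hreal : ∀ w : InfinitePlace ↥(maximalRealSubfield E), w.IsReal := fun w => IsTotallyReal.isReal w
  haveI := locallyCompact_infinitePart ((PlaneData.mixedRow q (a 0) (a 2)).withTransportedTorus g g' hgg' hg'g hgΩ)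
  have hgrowth : ArchBallGrowth ((PlaneData.mixedRow q (a 0) (a 2)).withTransportedTorus g g' hgg' hg'g hgΩ)
      (Measure.haar : Measure (infinitePart ((PlaneData.mixedRow q (a 0) (a 2)).withTransportedTorus g g' hgg' hg'g hgΩ))) :=
    archBallGrowth_seesaw_of_seesawDefinite q a φ _hpos g g' hgg' hg'g hgΩ hreal hcm hSD Measure.haar
  exact d3CoeffData'_seesawR q a _ha φ _hpos g g' hgg' hg'g hgΩ lam _hlam _hiso R eP eM eP' eM' _he _he' _hchi' μ DG fdG
    compG compT compT' hcm γ₀ νinf νinf' Measure.haar hgrowth Rc hRc hF hpseudo hpseudo'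

/-- the `∃ Rc` packaging (`d3CoeffData'_seesawR_exists`) with `hgrowth` discharged from `SeesawDefinite`. -/
theorem d3CoeffData'_seesawR_exists_of_seesawDefinite (q : QuadData ↥(maximalRealSubfield E)) (a : Fin 4 → ↥(maximalRealSubfield E))
    (_ha : ∀ i, a i ≠ 0) (φ : ↥(maximalRealSubfield E) →+* ℂ) (_hpos : ∀ i, 0 < (φ (a i)).re)
    (g g' : Matrix (Fin 4) (Fin 4) ↥(maximalRealSubfield E)) (hgg' : g * g' = 1) (hg'g : g' * g = 1)
    (hgΩ : g * (PlaneData.mixedRow q (a 0) (a 2)).Ω = (PlaneData.mixedRow q (a 0) (a 2)).Ω * g)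
    (lam : ↥(maximalRealSubfield E)) (_hlam : lam ≠ 0)
    (_hiso : g * (PlaneData.mixedRow q (a 1) (a 3)).B * gᵀ = lam • (PlaneData.mixedRow q (a 0) (a 2)).B)
    [MeasurableSpace (GA ((PlaneData.mixedRow q (a 0) (a 2)).withTransportedTorus g g' hgg' hg'g hgΩ))]
    [BorelSpace (GA ((PlaneData.mixedRow q (a 0) (a 2)).withTransportedTorus g g' hgg' hg'g hgΩ))]
    (R : RTFData ((PlaneData.mixedRow q (a 0) (a 2)).withTransportedTorus g g' hgg' hg'g hgΩ))
    [R.μT.IsHaarMeasure] [R.μT'.IsHaarMeasure]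
    (eP eM eP' eM' : InfinitePlace ↥(maximalRealSubfield E) → ℤ)
    (_he : eP (InfinitePlace.mk φ) - eM (InfinitePlace.mk φ) = 3 ∨ eP (InfinitePlace.mk φ) - eM (InfinitePlace.mk φ) = -3)
    (_he' : (0 < (φ lam).re → eP' (InfinitePlace.mk φ) - eM' (InfinitePlace.mk φ) =
        eP (InfinitePlace.mk φ) - eM (InfinitePlace.mk φ)) ∧
      ((φ lam).re < 0 → eP' (InfinitePlace.mk φ) - eM' (InfinitePlace.mk φ) =
        -(eP (InfinitePlace.mk φ) - eM (InfinitePlace.mk φ))))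
    (_hchi' : ∀ w : InfinitePlace ↥(maximalRealSubfield E),
      ChiMatchesAt' ((PlaneData.mixedRow q (a 0) (a 2)).withTransportedTorus g g' hgg' hg'g hgΩ) q w g g' (eP' w) (eM' w)
        R.chi')
    (μ : Measure (GA ((PlaneData.mixedRow q (a 0) (a 2)).withTransportedTorus g g' hgg' hg'g hgΩ))) [μ.IsHaarMeasure]
    (DG : Set (GA ((PlaneData.mixedRow q (a 0) (a 2)).withTransportedTorus g g' hgg' hg'g hgΩ)))
    (fdG : IsFundamentalDomain (rationalPoints ((PlaneData.mixedRow q (a 0) (a 2)).withTransportedTorus g g' hgg' hg'g hgΩ))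
      DG μ)
    (compG : IsCompact (closure DG)) (compT : IsCompact (closure R.DT)) (compT' : IsCompact (closure R.DT'))
    (hcm : ∀ w : InfinitePlace ↥(maximalRealSubfield E), IsCMAt q w)
    (γ₀ : GA ((PlaneData.mixedRow q (a 0) (a 2)).withTransportedTorus g g' hgg' hg'g hgΩ))
    (νinf : Measure (torusInf ((PlaneData.mixedRow q (a 0) (a 2)).withTransportedTorus g g' hgg' hg'g hgΩ)))
    (νinf' : Measure (torusInf' ((PlaneData.mixedRow q (a 0) (a 2)).withTransportedTorus g g' hgg' hg'g hgΩ)))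
    [νinf'.IsHaarMeasure]
    (hSD : SeesawDefinite q a (InfinitePlace.mk φ))
    (h : ∃ Rc : ℝ, 0 ≤ Rc ∧
      ((∫ t : torusInf ((PlaneData.mixedRow q (a 0) (a 2)).withTransportedTorus g g' hgg' hg'g hgΩ),
        R.chi t * archWitnessROf q a g g' hgg' hg'g hgΩ lam _hiso (InfinitePlace.mk φ) eP' eM' Rc
          (((t : torusT ((PlaneData.mixedRow q (a 0) (a 2)).withTransportedTorus g g' hgg' hg'g hgΩ)) :
            GA ((PlaneData.mixedRow q (a 0) (a 2)).withTransportedTorus g g' hgg' hg'g hgΩ))⁻¹ * γ₀) ∂νinf) ≠ 0) ∧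
      (∀ ffin : GA ((PlaneData.mixedRow q (a 0) (a 2)).withTransportedTorus g g' hgg' hg'g hgΩ) → ℂ,
      L1Class.IsFinFactor ((PlaneData.mixedRow q (a 0) (a 2)).withTransportedTorus g g' hgg' hg'g hgΩ) ffin →
      IsPseudoCoeffAt ((PlaneData.mixedRow q (a 0) (a 2)).withTransportedTorus g g' hgg' hg'g hgΩ)
        (Setting.ofAdelicData ((PlaneData.mixedRow q (a 0) (a 2)).withTransportedTorus g g' hgg' hg'g hgΩ) R μ DG fdG
          compG compT compT') q (InfinitePlace.mk φ) eP eM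
        (RTF.cj (L1Class.prodFn ((PlaneData.mixedRow q (a 0) (a 2)).withTransportedTorus g g' hgg' hg'g hgΩ)
          (archWitnessROf q a g g' hgg' hg'g hgΩ lam _hiso (InfinitePlace.mk φ) eP' eM' Rc) ffin))) ∧
      (∀ ffin : GA ((PlaneData.mixedRow q (a 0) (a 2)).withTransportedTorus g g' hgg' hg'g hgΩ) → ℂ,
      L1Class.IsFinFactor ((PlaneData.mixedRow q (a 0) (a 2)).withTransportedTorus g g' hgg' hg'g hgΩ) ffin →
      IsPseudoCoeffAt' ((PlaneData.mixedRow q (a 0) (a 2)).withTransportedTorus g g' hgg' hg'g hgΩ)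
        (Setting.ofAdelicData ((PlaneData.mixedRow q (a 0) (a 2)).withTransportedTorus g g' hgg' hg'g hgΩ) R μ DG fdG
          compG compT compT') q g g' (InfinitePlace.mk φ) eP' eM'
        (RTF.cj (L1Class.prodFn ((PlaneData.mixedRow q (a 0) (a 2)).withTransportedTorus g g' hgg' hg'g hgΩ)
          (archWitnessROf q a g g' hgg' hg'g hgΩ lam _hiso (InfinitePlace.mk φ) eP' eM' Rc) ffin)))) :
    L1Class.D3CoeffData' ((PlaneData.mixedRow q (a 0) (a 2)).withTransportedTorus g g' hgg' hg'g hgΩ)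
      (Setting.ofAdelicData ((PlaneData.mixedRow q (a 0) (a 2)).withTransportedTorus g g' hgg' hg'g hgΩ) R μ DG fdG
          compG compT compT') R q g g' (InfinitePlace.mk φ) eP eM eP' eM' γ₀ νinf νinf' := by
  have hreal : ∀ w : InfinitePlace ↥(maximalRealSubfield E), w.IsReal := fun w => IsTotallyReal.isReal w
  haveI := locallyCompact_infinitePart ((PlaneData.mixedRow q (a 0) (a 2)).withTransportedTorus g g' hgg' hg'g hgΩ)
  have hgrowth : ArchBallGrowth ((PlaneData.mixedRow q (a 0) (a 2)).withTransportedTorus g g' hgg' hg'g hgΩ)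
      (Measure.haar : Measure (infinitePart ((PlaneData.mixedRow q (a 0) (a 2)).withTransportedTorus g g' hgg' hg'g hgΩ))) :=
    archBallGrowth_seesaw_of_seesawDefinite q a φ _hpos g g' hgg' hg'g hgΩ hreal hcm hSD Measure.haar
  exact d3CoeffData'_seesawR_exists q a _ha φ _hpos g g' hgg' hg'g hgΩ lam _hlam _hiso R eP eM eP' eM' _he _he' _hchi' μ DG fdG
    compG compT compT' hcm γ₀ νinf νinf' Measure.haar hgrowth h

/-- the radius-free packaging (`d3CoeffData'_seesawR_of_uncut`) with `hgrowth` discharged from `SeesawDefinite`. -/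
theorem d3CoeffData'_seesawR_of_uncut_of_seesawDefinite (q : QuadData ↥(maximalRealSubfield E)) (a : Fin 4 → ↥(maximalRealSubfield E))
    (_ha : ∀ i, a i ≠ 0) (φ : ↥(maximalRealSubfield E) →+* ℂ) (_hpos : ∀ i, 0 < (φ (a i)).re)
    (g g' : Matrix (Fin 4) (Fin 4) ↥(maximalRealSubfield E)) (hgg' : g * g' = 1) (hg'g : g' * g = 1)
    (hgΩ : g * (PlaneData.mixedRow q (a 0) (a 2)).Ω = (PlaneData.mixedRow q (a 0) (a 2)).Ω * g)
    (lam : ↥(maximalRealSubfield E)) (_hlam : lam ≠ 0)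
    (_hiso : g * (PlaneData.mixedRow q (a 1) (a 3)).B * gᵀ = lam • (PlaneData.mixedRow q (a 0) (a 2)).B)
    [MeasurableSpace (GA ((PlaneData.mixedRow q (a 0) (a 2)).withTransportedTorus g g' hgg' hg'g hgΩ))]
    [BorelSpace (GA ((PlaneData.mixedRow q (a 0) (a 2)).withTransportedTorus g g' hgg' hg'g hgΩ))]
    (R : RTFData ((PlaneData.mixedRow q (a 0) (a 2)).withTransportedTorus g g' hgg' hg'g hgΩ))
    [R.μT.IsHaarMeasure] [R.μT'.IsHaarMeasure]
    (eP eM eP' eM' : InfinitePlace ↥(maximalRealSubfield E) → ℤ)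
    (_he : eP (InfinitePlace.mk φ) - eM (InfinitePlace.mk φ) = 3 ∨ eP (InfinitePlace.mk φ) - eM (InfinitePlace.mk φ) = -3)
    (_he' : (0 < (φ lam).re → eP' (InfinitePlace.mk φ) - eM' (InfinitePlace.mk φ) =
        eP (InfinitePlace.mk φ) - eM (InfinitePlace.mk φ)) ∧
      ((φ lam).re < 0 → eP' (InfinitePlace.mk φ) - eM' (InfinitePlace.mk φ) =
        -(eP (InfinitePlace.mk φ) - eM (InfinitePlace.mk φ))))
    (_hchi' : ∀ w : InfinitePlace ↥(maximalRealSubfield E),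
      ChiMatchesAt' ((PlaneData.mixedRow q (a 0) (a 2)).withTransportedTorus g g' hgg' hg'g hgΩ) q w g g' (eP' w) (eM' w)
        R.chi')
    (μ : Measure (GA ((PlaneData.mixedRow q (a 0) (a 2)).withTransportedTorus g g' hgg' hg'g hgΩ))) [μ.IsHaarMeasure]
    (DG : Set (GA ((PlaneData.mixedRow q (a 0) (a 2)).withTransportedTorus g g' hgg' hg'g hgΩ)))
    (fdG : IsFundamentalDomain (rationalPoints ((PlaneData.mixedRow q (a 0) (a 2)).withTransportedTorus g g' hgg' hg'g hgΩ))
      DG μ)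
    (compG : IsCompact (closure DG)) (compT : IsCompact (closure R.DT)) (compT' : IsCompact (closure R.DT'))
    (hcm : ∀ w : InfinitePlace ↥(maximalRealSubfield E), IsCMAt q w)
    (γ₀ : GA ((PlaneData.mixedRow q (a 0) (a 2)).withTransportedTorus g g' hgg' hg'g hgΩ))
    (νinf : Measure (torusInf ((PlaneData.mixedRow q (a 0) (a 2)).withTransportedTorus g g' hgg' hg'g hgΩ)))
    (νinf' : Measure (torusInf' ((PlaneData.mixedRow q (a 0) (a 2)).withTransportedTorus g g' hgg' hg'g hgΩ)))
    [νinf'.IsHaarMeasure]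
    (hSD : SeesawDefinite q a (InfinitePlace.mk φ))
    (hF : (∫ t : torusInf ((PlaneData.mixedRow q (a 0) (a 2)).withTransportedTorus g g' hgg' hg'g hgΩ),
        R.chi t * archWitnessOf q a g g' hgg' hg'g hgΩ lam _hiso (InfinitePlace.mk φ) eP' eM'
          (((t : torusT ((PlaneData.mixedRow q (a 0) (a 2)).withTransportedTorus g g' hgg' hg'g hgΩ)) :
            GA ((PlaneData.mixedRow q (a 0) (a 2)).withTransportedTorus g g' hgg' hg'g hgΩ))⁻¹ * γ₀) ∂νinf) ≠ 0)
    (hpseudo_cof : ∀ Rb : ℝ, ∃ Rc : ℝ, Rb ≤ Rc ∧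
      (∀ ffin : GA ((PlaneData.mixedRow q (a 0) (a 2)).withTransportedTorus g g' hgg' hg'g hgΩ) → ℂ,
        L1Class.IsFinFactor ((PlaneData.mixedRow q (a 0) (a 2)).withTransportedTorus g g' hgg' hg'g hgΩ) ffin →
        IsPseudoCoeffAt ((PlaneData.mixedRow q (a 0) (a 2)).withTransportedTorus g g' hgg' hg'g hgΩ)
          (Setting.ofAdelicData ((PlaneData.mixedRow q (a 0) (a 2)).withTransportedTorus g g' hgg' hg'g hgΩ) R μ DG fdG
          compG compT compT') q (InfinitePlace.mk φ) eP eM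
          (RTF.cj (L1Class.prodFn ((PlaneData.mixedRow q (a 0) (a 2)).withTransportedTorus g g' hgg' hg'g hgΩ)
            (archWitnessROf q a g g' hgg' hg'g hgΩ lam _hiso (InfinitePlace.mk φ) eP' eM' Rc) ffin))) ∧
      (∀ ffin : GA ((PlaneData.mixedRow q (a 0) (a 2)).withTransportedTorus g g' hgg' hg'g hgΩ) → ℂ,
        L1Class.IsFinFactor ((PlaneData.mixedRow q (a 0) (a 2)).withTransportedTorus g g' hgg' hg'g hgΩ) ffin →
        IsPseudoCoeffAt' ((PlaneData.mixedRow q (a 0) (a 2)).withTransportedTorus g g' hgg' hg'g hgΩ)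
          (Setting.ofAdelicData ((PlaneData.mixedRow q (a 0) (a 2)).withTransportedTorus g g' hgg' hg'g hgΩ) R μ DG fdG
          compG compT compT') q g g' (InfinitePlace.mk φ) eP' eM'
          (RTF.cj (L1Class.prodFn ((PlaneData.mixedRow q (a 0) (a 2)).withTransportedTorus g g' hgg' hg'g hgΩ)
            (archWitnessROf q a g g' hgg' hg'g hgΩ lam _hiso (InfinitePlace.mk φ) eP' eM' Rc) ffin)))) :
    L1Class.D3CoeffData' ((PlaneData.mixedRow q (a 0) (a 2)).withTransportedTorus g g' hgg' hg'g hgΩ)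
      (Setting.ofAdelicData ((PlaneData.mixedRow q (a 0) (a 2)).withTransportedTorus g g' hgg' hg'g hgΩ) R μ DG fdG
          compG compT compT') R q g g' (InfinitePlace.mk φ) eP eM eP' eM' γ₀ νinf νinf' := by
  have hreal : ∀ w : InfinitePlace ↥(maximalRealSubfield E), w.IsReal := fun w => IsTotallyReal.isReal w
  haveI := locallyCompact_infinitePart ((PlaneData.mixedRow q (a 0) (a 2)).withTransportedTorus g g' hgg' hg'g hgΩ)
  have hgrowth : ArchBallGrowth ((PlaneData.mixedRow q (a 0) (a 2)).withTransportedTorus g g' hgg' hg'g hgΩ)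
      (Measure.haar : Measure (infinitePart ((PlaneData.mixedRow q (a 0) (a 2)).withTransportedTorus g g' hgg' hg'g hgΩ))) :=
    archBallGrowth_seesaw_of_seesawDefinite q a φ _hpos g g' hgg' hg'g hgΩ hreal hcm hSD Measure.haar
  exact d3CoeffData'_seesawR_of_uncut q a _ha φ _hpos g g' hgg' hg'g hgΩ lam _hlam _hiso R eP eM eP' eM' _he _he' _hchi' μ DG fdG
    compG compT compT' hcm γ₀ νinf νinf' Measure.haar hgrowth hF hpseudo_cof

end Seesaw

end Summit.Ventures.HodgeRepro.Tier4.Line4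

end
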